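import Mathlib
import Summits.AtomisticToContinuum.Crystallization.Theorems.NashClassCertificatesNashNearFieldStubLayerLandscapeTri

/-!
# Crux `NashNearField` (16827), stub `stub_triLandscapeNearOblique` (NEAR′): exact structure of the layer sums near the family —
# the deformed squared distance is exactly quadratic in the strain, and the `C₃` pairing kills every transverse linear term

Two certificate-design facts for the second-order certificate of NEAR′ (`W(t; a′, h′) ≥ c·S′²` near the box family), both exact
identities (no estimates):

* `tri_q_expand` — with `T = D + E`, `D = diag(a, a, κ)` and `E` upper triangular, the deformed squared distance of the template
  vector `(X, Y, Z)` is EXACTLY `q₀ + 2ℓ·E + |E v|²`: `q₀ = (aX)² + (aY)² + (κZ)²`, the linear form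
  `ℓ·E = aX(e₀₀X + e₀₁Y + e₀₂Z) + aY(e₁₁Y + e₁₂Z) + κZ·e₂₂Z` and the square `|Ev|² = (e₀₀X + e₀₁Y + e₀₂Z)² + (e₁₁Y + e₁₂Z)² + (e₂₂Z)²`
  — so all non-polynomial behaviour of a retained term `V_LJ(√q)` is one-dimensional (through `q ↦ q⁻⁶/12 − q⁻³/6`).
* `tri_C3_sum_eq_zero` / `tri_C3_tsum_eq_zero` — the index map `ρ : (i, j) ↦ (−i−j−δ, i)` is a bijection of `ℤ²` of order `3`
  acting on the in-plane coordinates `X = i + j/2 + δ/2`, `Y = (√3/2)(j + δ/3)` of the `δ`-shifted triangular layer as the rotation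
  by `120°` (`tri_rot_X`, `tri_rot_Y`; `X² + Y²` is invariant, `tri_rot_Q`).  Hence for every `ρ`-invariant weight `w` and every
  `ρ`-invariant finite set (or over all of `ℤ²`, given summability) the sums of `w·X`, `w·Y`, `w·(X² − Y²)`, `w·XY` vanish.
  `tri_C3_firstOrder` is the form used by the certificate: for a radial weight the first-order strain term of a layer sum,
  `∑ w·(ℓ_v·E)`, only sees the two TANGENTIAL strains `(e₀₀ + e₁₁)/2` and `e₂₂`:
  `∑_F w·(ℓ_v·E) = ∑_F w·(a·(e₀₀+e₁₁)/2·(X²+Y²) + κ e₂₂ Z²)` — the box family is transversally critical for every layer-pair sum.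
-/

noncomputable section

open scoped BigOperators
open Literature.MathematicalPhysics.StatisticalMechanics Literature.Geometry.DiscreteGeometry

namespace Summit.AtomisticToContinuum.Crystallization.Theorems.NashClassCertificatesNashNearField

/-- **Exact quadratic structure of the deformed squared distance**: for `T = D + E`, `D = diag(a, a, κ)`, `E` upper triangular,
`q_T(X,Y,Z) = q₀ + 2ℓ·E + |Ev|²` identically. [folklore] -/
theorem tri_q_expand (a κ e₀₀ e₀₁ e₀₂ e₁₁ e₁₂ e₂₂ X Y Z : ℝ) :
    ((a + e₀₀) * X + e₀₁ * Y + e₀₂ * Z) ^ 2 + ((a + e₁₁) * Y + e₁₂ * Z) ^ 2 + ((κ + e₂₂) * Z) ^ 2 =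
      ((a * X) ^ 2 + (a * Y) ^ 2 + (κ * Z) ^ 2) +
        2 * (a * X * (e₀₀ * X + e₀₁ * Y + e₀₂ * Z) + a * Y * (e₁₁ * Y + e₁₂ * Z) + κ * Z * (e₂₂ * Z)) +
        ((e₀₀ * X + e₀₁ * Y + e₀₂ * Z) ^ 2 + (e₁₁ * Y + e₁₂ * Z) ^ 2 + (e₂₂ * Z) ^ 2) := by
  ring

/-- The linear form `ℓ·E` split into its `C₃`-isotypic parts: radial (`X² + Y²`, `Z²`), the two quadratic harmonics
(`X² − Y²`, `XY`) and the two linear ones (`X`, `Y`). [folklore] -/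
theorem tri_ell_split (a κ e₀₀ e₀₁ e₀₂ e₁₁ e₁₂ e₂₂ X Y Z : ℝ) :
    a * X * (e₀₀ * X + e₀₁ * Y + e₀₂ * Z) + a * Y * (e₁₁ * Y + e₁₂ * Z) + κ * Z * (e₂₂ * Z) =
      (a * ((e₀₀ + e₁₁) / 2) * (X ^ 2 + Y ^ 2) + κ * e₂₂ * Z ^ 2) +
        (a * ((e₀₀ - e₁₁) / 2) * (X ^ 2 - Y ^ 2) + a * e₀₁ * (X * Y) + a * Z * e₀₂ * X + a * Z * e₁₂ * Y) := by
  ring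

/-! ## The `C₃` pairing `ρ : (i, j) ↦ (−i−j−δ, i)` -/

/-- `ρ` rotates the in-plane `X`-coordinate by `120°`: `X(ρ p) = −X/2 − (√3/2)·Y`. [folklore] -/
theorem tri_rot_X (δ i j : ℤ) :
    ((((-i - j - δ : ℤ)) : ℝ) + ((i : ℤ) : ℝ) / 2 + (δ : ℝ) / 2) =
      -(1 / 2) * ((i : ℝ) + (j : ℝ) / 2 + (δ : ℝ) / 2) - Real.sqrt 3 / 2 * (Real.sqrt 3 / 2 * ((j : ℝ) + (δ : ℝ) / 3)) := by
  have h3 : Real.sqrt 3 * Real.sqrt 3 = 3 := Real.mul_self_sqrt (by norm_num)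
  push_cast
  linear_combination (1 / 4 * ((j : ℝ) + (δ : ℝ) / 3)) * h3

/-- `ρ` rotates the in-plane `Y`-coordinate by `120°`: `Y(ρ p) = (√3/2)·X − Y/2`. [folklore] -/
theorem tri_rot_Y (δ i j : ℤ) :
    Real.sqrt 3 / 2 * ((((i : ℤ)) : ℝ) + (δ : ℝ) / 3) =
      Real.sqrt 3 / 2 * ((i : ℝ) + (j : ℝ) / 2 + (δ : ℝ) / 2) - (1 / 2) * (Real.sqrt 3 / 2 * ((j : ℝ) + (δ : ℝ) / 3)) := by
  ring

/-- `ρ` preserves the planar form `X² + Y²`. [folklore] -/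
theorem tri_rot_Q (δ i j : ℤ) :
    ((((-i - j - δ : ℤ)) : ℝ) + ((i : ℤ) : ℝ) / 2 + (δ : ℝ) / 2) ^ 2 + (Real.sqrt 3 / 2 * ((((i : ℤ)) : ℝ) + (δ : ℝ) / 3)) ^ 2 =
      ((i : ℝ) + (j : ℝ) / 2 + (δ : ℝ) / 2) ^ 2 + (Real.sqrt 3 / 2 * ((j : ℝ) + (δ : ℝ) / 3)) ^ 2 := by
  rw [tri_rot_X, tri_rot_Y]
  have h3 : Real.sqrt 3 * Real.sqrt 3 = 3 := Real.mul_self_sqrt (by norm_num)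
  linear_combination ((((i : ℝ) + (j : ℝ) / 2 + (δ : ℝ) / 2) ^ 2 + (Real.sqrt 3 / 2 * ((j : ℝ) + (δ : ℝ) / 3)) ^ 2) / 4) * h3

/-- `ρ` has order three: `ρ (ρ (ρ p)) = p`, so `ρ² = ρ⁻¹ = (i, j) ↦ (j, −i−j−δ)`. [folklore] -/
theorem tri_rot_three (δ : ℤ) (p : ℤ × ℤ) :
    (fun ij : ℤ × ℤ => (-ij.1 - ij.2 - δ, ij.1)) ((fun ij : ℤ × ℤ => (-ij.1 - ij.2 - δ, ij.1))
      ((fun ij : ℤ × ℤ => (-ij.1 - ij.2 - δ, ij.1)) p)) = p := by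
  obtain ⟨i, j⟩ := p
  simp only
  have h2 : -(-i - j - δ) - i - δ = j := by ring
  rw [h2]
  have h1 : -j - (-i - j - δ) - δ = i := by ring
  rw [h1]

/-- Reindexing a finite sum over a `ρ`-invariant set by `ρ`. [folklore] -/
theorem tri_rot_sum_eq (δ : ℤ) (F : Finset (ℤ × ℤ)) (hF : ∀ ij ∈ F, (-ij.1 - ij.2 - δ, ij.1) ∈ F) (f : ℤ × ℤ → ℝ) :
    ∑ ij ∈ F, f (-ij.1 - ij.2 - δ, ij.1) = ∑ ij ∈ F, f ij := by
  refine Finset.sum_nbij' (fun ij : ℤ × ℤ => (-ij.1 - ij.2 - δ, ij.1)) (fun ij : ℤ × ℤ => (ij.2, -ij.1 - ij.2 - δ)) hF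
    (fun ij hij => ?_) (fun ij _ => ?_) (fun ij _ => ?_) (fun ij _ => rfl)
  · have h1 := hF ij hij
    have h2 := hF _ h1
    obtain ⟨i, j⟩ := ij
    simp only at h2 ⊢
    have h : -(-i - j - δ) - i - δ = j := by ring
    rw [h] at h2
    exact h2
  · obtain ⟨i, j⟩ := ij
    simp only
    have h : -(-i - j - δ) - i - δ = j := by ring
    rw [h]
  · obtain ⟨i, j⟩ := ij
    simp only
    have h : -j - (-i - j - δ) - δ = i := by ring
    rw [h]

/-- **`C₃` kills the linear and quadratic harmonics (finite, `ρ`-invariant sets).**  For a `ρ`-invariant finite `F ⊆ ℤ²` and a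
`ρ`-invariant weight `w`, `∑_F w·(c₁X + c₂Y + c₃(X² − Y²) + c₄XY) = 0`. [folklore] -/
theorem tri_C3_sum_eq_zero (δ : ℤ) (F : Finset (ℤ × ℤ)) (hF : ∀ ij ∈ F, (-ij.1 - ij.2 - δ, ij.1) ∈ F)
    (w : ℤ × ℤ → ℝ) (hw : ∀ ij : ℤ × ℤ, w (-ij.1 - ij.2 - δ, ij.1) = w ij) (c₁ c₂ c₃ c₄ : ℝ) :
    ∑ ij ∈ F, w ij * (c₁ * ((ij.1 : ℝ) + (ij.2 : ℝ) / 2 + (δ : ℝ) / 2) + c₂ * (Real.sqrt 3 / 2 * ((ij.2 : ℝ) + (δ : ℝ) / 3)) +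
        c₃ * (((ij.1 : ℝ) + (ij.2 : ℝ) / 2 + (δ : ℝ) / 2) ^ 2 - (Real.sqrt 3 / 2 * ((ij.2 : ℝ) + (δ : ℝ) / 3)) ^ 2) +
        c₄ * (((ij.1 : ℝ) + (ij.2 : ℝ) / 2 + (δ : ℝ) / 2) * (Real.sqrt 3 / 2 * ((ij.2 : ℝ) + (δ : ℝ) / 3)))) = 0 := by
  set X : ℤ × ℤ → ℝ := fun ij => (ij.1 : ℝ) + (ij.2 : ℝ) / 2 + (δ : ℝ) / 2 with hX
  set Y : ℤ × ℤ → ℝ := fun ij => Real.sqrt 3 / 2 * ((ij.2 : ℝ) + (δ : ℝ) / 3) with hY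
  have h3 : Real.sqrt 3 * Real.sqrt 3 = 3 := Real.mul_self_sqrt (by norm_num)
  -- the rotated coordinates
  have rX : ∀ ij : ℤ × ℤ, X (-ij.1 - ij.2 - δ, ij.1) = -(1 / 2) * X ij - Real.sqrt 3 / 2 * Y ij := by
    intro ij; simp only [hX, hY]; have := tri_rot_X δ ij.1 ij.2; push_cast at this ⊢; linear_combination this
  have rY : ∀ ij : ℤ × ℤ, Y (-ij.1 - ij.2 - δ, ij.1) = Real.sqrt 3 / 2 * X ij - (1 / 2) * Y ij := by
    intro ij; simp only [hX, hY]; ring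
  -- the four sums and their rotation equations
  set S := ∑ ij ∈ F, w ij * X ij with hS
  set T := ∑ ij ∈ F, w ij * Y ij with hT
  set U := ∑ ij ∈ F, w ij * (X ij ^ 2 - Y ij ^ 2) with hU
  set V := ∑ ij ∈ F, w ij * (X ij * Y ij) with hV
  have eS : S = -(1 / 2) * S - Real.sqrt 3 / 2 * T := by
    calc S = ∑ ij ∈ F, w (-ij.1 - ij.2 - δ, ij.1) * X (-ij.1 - ij.2 - δ, ij.1) :=
          (tri_rot_sum_eq δ F hF (fun ij => w ij * X ij)).symm
      _ = ∑ ij ∈ F, (-(1 / 2) * (w ij * X ij) - Real.sqrt 3 / 2 * (w ij * Y ij)) :=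
          Finset.sum_congr rfl fun ij _ => by rw [hw, rX]; ring
      _ = -(1 / 2) * S - Real.sqrt 3 / 2 * T := by
          rw [Finset.sum_sub_distrib, ← Finset.mul_sum, ← Finset.mul_sum]
  have eT : T = Real.sqrt 3 / 2 * S - (1 / 2) * T := by
    calc T = ∑ ij ∈ F, w (-ij.1 - ij.2 - δ, ij.1) * Y (-ij.1 - ij.2 - δ, ij.1) :=
          (tri_rot_sum_eq δ F hF (fun ij => w ij * Y ij)).symm
      _ = ∑ ij ∈ F, (Real.sqrt 3 / 2 * (w ij * X ij) - (1 / 2) * (w ij * Y ij)) :=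
          Finset.sum_congr rfl fun ij _ => by rw [hw, rY]; ring
      _ = Real.sqrt 3 / 2 * S - (1 / 2) * T := by
          rw [Finset.sum_sub_distrib, ← Finset.mul_sum, ← Finset.mul_sum]
  have eU : U = -(1 / 2) * U + Real.sqrt 3 * V := by
    calc U = ∑ ij ∈ F, w (-ij.1 - ij.2 - δ, ij.1) * (X (-ij.1 - ij.2 - δ, ij.1) ^ 2 - Y (-ij.1 - ij.2 - δ, ij.1) ^ 2) :=
          (tri_rot_sum_eq δ F hF (fun ij => w ij * (X ij ^ 2 - Y ij ^ 2))).symm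
      _ = ∑ ij ∈ F, (-(1 / 2) * (w ij * (X ij ^ 2 - Y ij ^ 2)) + Real.sqrt 3 * (w ij * (X ij * Y ij))) :=
          Finset.sum_congr rfl fun ij _ => by
            rw [hw, rX, rY]; linear_combination (-(w ij * (X ij ^ 2 - Y ij ^ 2)) / 4) * h3
      _ = -(1 / 2) * U + Real.sqrt 3 * V := by
          rw [Finset.sum_add_distrib, ← Finset.mul_sum, ← Finset.mul_sum]
  have eV : V = -(Real.sqrt 3 / 4) * U - (1 / 2) * V := by
    calc V = ∑ ij ∈ F, w (-ij.1 - ij.2 - δ, ij.1) * (X (-ij.1 - ij.2 - δ, ij.1) * Y (-ij.1 - ij.2 - δ, ij.1)) :=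
          (tri_rot_sum_eq δ F hF (fun ij => w ij * (X ij * Y ij))).symm
      _ = ∑ ij ∈ F, (-(Real.sqrt 3 / 4) * (w ij * (X ij ^ 2 - Y ij ^ 2)) - (1 / 2) * (w ij * (X ij * Y ij))) :=
          Finset.sum_congr rfl fun ij _ => by
            rw [hw, rX, rY]; linear_combination (-(1 / 4) * w ij * (X ij * Y ij)) * h3
      _ = -(Real.sqrt 3 / 4) * U - (1 / 2) * V := by
          rw [Finset.sum_sub_distrib, ← Finset.mul_sum, ← Finset.mul_sum]
  have hS0 : S = 0 := by linear_combination (1 / 2 : ℝ) * eS - (Real.sqrt 3 / 6) * eT - (S / 12) * h3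
  have hT0 : T = 0 := by linear_combination (2 / 3 : ℝ) * eT + (Real.sqrt 3 / 3) * hS0
  have hU0 : U = 0 := by linear_combination (1 / 2 : ℝ) * eU + (Real.sqrt 3 / 3) * eV - (U / 12) * h3
  have hV0 : V = 0 := by linear_combination (2 / 3 : ℝ) * eV - (Real.sqrt 3 / 6) * hU0
  -- assemble
  have e : ∑ ij ∈ F, w ij * (c₁ * X ij + c₂ * Y ij + c₃ * (X ij ^ 2 - Y ij ^ 2) + c₄ * (X ij * Y ij)) =
      c₁ * S + c₂ * T + c₃ * U + c₄ * V := by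
    simp only [hS, hT, hU, hV, Finset.mul_sum, ← Finset.sum_add_distrib]
    exact Finset.sum_congr rfl fun ij _ => by ring
  show ∑ ij ∈ F, w ij * (c₁ * X ij + c₂ * Y ij + c₃ * (X ij ^ 2 - Y ij ^ 2) + c₄ * (X ij * Y ij)) = 0
  rw [e, hS0, hT0, hU0, hV0]; ring

/-- **Transverse criticality of the family, finite form (the shape used by the certificate).**  For a `ρ`-invariant finite
`F ⊆ ℤ²` and a `ρ`-invariant weight `w` (e.g. `w = V′`-type radial weights, functions of `X² + Y²`), the first-order strain term
`∑_F w·(ℓ_v·E)` of a layer sum at layer coordinate `Z` only sees the tangential strains `(e₀₀ + e₁₁)/2` and `e₂₂`. [folklore] -/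
theorem tri_C3_firstOrder (δ : ℤ) (F : Finset (ℤ × ℤ)) (hF : ∀ ij ∈ F, (-ij.1 - ij.2 - δ, ij.1) ∈ F)
    (w : ℤ × ℤ → ℝ) (hw : ∀ ij : ℤ × ℤ, w (-ij.1 - ij.2 - δ, ij.1) = w ij) (a κ e₀₀ e₀₁ e₀₂ e₁₁ e₁₂ e₂₂ Z : ℝ) :
    ∑ ij ∈ F, w ij * (a * ((ij.1 : ℝ) + (ij.2 : ℝ) / 2 + (δ : ℝ) / 2) *
        (e₀₀ * ((ij.1 : ℝ) + (ij.2 : ℝ) / 2 + (δ : ℝ) / 2) + e₀₁ * (Real.sqrt 3 / 2 * ((ij.2 : ℝ) + (δ : ℝ) / 3)) + e₀₂ * Z) +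
        a * (Real.sqrt 3 / 2 * ((ij.2 : ℝ) + (δ : ℝ) / 3)) * (e₁₁ * (Real.sqrt 3 / 2 * ((ij.2 : ℝ) + (δ : ℝ) / 3)) + e₁₂ * Z) +
        κ * Z * (e₂₂ * Z)) =
      ∑ ij ∈ F, w ij * (a * ((e₀₀ + e₁₁) / 2) * (((ij.1 : ℝ) + (ij.2 : ℝ) / 2 + (δ : ℝ) / 2) ^ 2 +
        (Real.sqrt 3 / 2 * ((ij.2 : ℝ) + (δ : ℝ) / 3)) ^ 2) + κ * e₂₂ * Z ^ 2) := by
  have h0 := tri_C3_sum_eq_zero δ F hF w hw (a * Z * e₀₂) (a * Z * e₁₂) (a * ((e₀₀ - e₁₁) / 2)) (a * e₀₁)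
  rw [← sub_eq_zero, ← Finset.sum_sub_distrib, ← h0]
  exact Finset.sum_congr rfl fun ij _ => by ring

/-- **`C₃` kills the linear and quadratic harmonics over all of `ℤ²`** (given summability of the four pieces). [folklore] -/
theorem tri_C3_tsum_eq_zero (δ : ℤ) (w : ℤ × ℤ → ℝ) (hw : ∀ ij : ℤ × ℤ, w (-ij.1 - ij.2 - δ, ij.1) = w ij)
    (hX : Summable fun ij : ℤ × ℤ => w ij * ((ij.1 : ℝ) + (ij.2 : ℝ) / 2 + (δ : ℝ) / 2))
    (hY : Summable fun ij : ℤ × ℤ => w ij * (Real.sqrt 3 / 2 * ((ij.2 : ℝ) + (δ : ℝ) / 3)))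
    (hU : Summable fun ij : ℤ × ℤ => w ij * (((ij.1 : ℝ) + (ij.2 : ℝ) / 2 + (δ : ℝ) / 2) ^ 2 - (Real.sqrt 3 / 2 * ((ij.2 : ℝ) + (δ : ℝ) / 3)) ^ 2))
    (hV : Summable fun ij : ℤ × ℤ => w ij * (((ij.1 : ℝ) + (ij.2 : ℝ) / 2 + (δ : ℝ) / 2) * (Real.sqrt 3 / 2 * ((ij.2 : ℝ) + (δ : ℝ) / 3))))
    (c₁ c₂ c₃ c₄ : ℝ) :
    ∑' ij : ℤ × ℤ, w ij * (c₁ * ((ij.1 : ℝ) + (ij.2 : ℝ) / 2 + (δ : ℝ) / 2) + c₂ * (Real.sqrt 3 / 2 * ((ij.2 : ℝ) + (δ : ℝ) / 3)) +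
        c₃ * (((ij.1 : ℝ) + (ij.2 : ℝ) / 2 + (δ : ℝ) / 2) ^ 2 - (Real.sqrt 3 / 2 * ((ij.2 : ℝ) + (δ : ℝ) / 3)) ^ 2) +
        c₄ * (((ij.1 : ℝ) + (ij.2 : ℝ) / 2 + (δ : ℝ) / 2) * (Real.sqrt 3 / 2 * ((ij.2 : ℝ) + (δ : ℝ) / 3)))) = 0 := by
  set X : ℤ × ℤ → ℝ := fun ij => (ij.1 : ℝ) + (ij.2 : ℝ) / 2 + (δ : ℝ) / 2 with hXd
  set Y : ℤ × ℤ → ℝ := fun ij => Real.sqrt 3 / 2 * ((ij.2 : ℝ) + (δ : ℝ) / 3) with hYd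
  have h3 : Real.sqrt 3 * Real.sqrt 3 = 3 := Real.mul_self_sqrt (by norm_num)
  have rX : ∀ ij : ℤ × ℤ, X (-ij.1 - ij.2 - δ, ij.1) = -(1 / 2) * X ij - Real.sqrt 3 / 2 * Y ij := by
    intro ij; simp only [hXd, hYd]; have := tri_rot_X δ ij.1 ij.2; push_cast at this ⊢; linear_combination this
  have rY : ∀ ij : ℤ × ℤ, Y (-ij.1 - ij.2 - δ, ij.1) = Real.sqrt 3 / 2 * X ij - (1 / 2) * Y ij := by
    intro ij; simp only [hXd, hYd]; ring
  -- `ρ` as an equivalence of `ℤ²`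
  let ρ : ℤ × ℤ ≃ ℤ × ℤ :=
    { toFun := fun ij => (-ij.1 - ij.2 - δ, ij.1)
      invFun := fun ij => (ij.2, -ij.1 - ij.2 - δ)
      left_inv := fun ij => by
        obtain ⟨i, j⟩ := ij
        simp only
        have h : -(-i - j - δ) - i - δ = j := by ring
        rw [h]
      right_inv := fun ij => by
        obtain ⟨i, j⟩ := ij
        simp only
        have h : -j - (-i - j - δ) - δ = i := by ring
        rw [h] }
  have hρ : ∀ ij, ρ ij = (-ij.1 - ij.2 - δ, ij.1) := fun _ => rfl
  set S := ∑' ij : ℤ × ℤ, w ij * X ij with hS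
  set T := ∑' ij : ℤ × ℤ, w ij * Y ij with hT
  set U := ∑' ij : ℤ × ℤ, w ij * (X ij ^ 2 - Y ij ^ 2) with hUd
  set V := ∑' ij : ℤ × ℤ, w ij * (X ij * Y ij) with hVd
  have eS : S = -(1 / 2) * S - Real.sqrt 3 / 2 * T := by
    calc S = ∑' ij : ℤ × ℤ, w (ρ ij) * X (ρ ij) := (Equiv.tsum_eq ρ (fun ij => w ij * X ij)).symm
      _ = ∑' ij : ℤ × ℤ, (-(1 / 2) * (w ij * X ij) - Real.sqrt 3 / 2 * (w ij * Y ij)) :=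
          tsum_congr fun ij => by rw [hρ, hw, rX]; ring
      _ = -(1 / 2) * S - Real.sqrt 3 / 2 * T := by
          rw [(hX.mul_left _).tsum_sub (hY.mul_left _), tsum_mul_left, tsum_mul_left]
  have eT : T = Real.sqrt 3 / 2 * S - (1 / 2) * T := by
    calc T = ∑' ij : ℤ × ℤ, w (ρ ij) * Y (ρ ij) := (Equiv.tsum_eq ρ (fun ij => w ij * Y ij)).symm
      _ = ∑' ij : ℤ × ℤ, (Real.sqrt 3 / 2 * (w ij * X ij) - (1 / 2) * (w ij * Y ij)) :=
          tsum_congr fun ij => by rw [hρ, hw, rY]; ring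
      _ = Real.sqrt 3 / 2 * S - (1 / 2) * T := by
          rw [(hX.mul_left _).tsum_sub (hY.mul_left _), tsum_mul_left, tsum_mul_left]
  have eU : U = -(1 / 2) * U + Real.sqrt 3 * V := by
    calc U = ∑' ij : ℤ × ℤ, w (ρ ij) * (X (ρ ij) ^ 2 - Y (ρ ij) ^ 2) :=
          (Equiv.tsum_eq ρ (fun ij => w ij * (X ij ^ 2 - Y ij ^ 2))).symm
      _ = ∑' ij : ℤ × ℤ, (-(1 / 2) * (w ij * (X ij ^ 2 - Y ij ^ 2)) + Real.sqrt 3 * (w ij * (X ij * Y ij))) :=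
          tsum_congr fun ij => by
            rw [hρ, hw, rX, rY]; linear_combination (-(w ij * (X ij ^ 2 - Y ij ^ 2)) / 4) * h3
      _ = -(1 / 2) * U + Real.sqrt 3 * V := by
          rw [(hU.mul_left _).tsum_add (hV.mul_left _), tsum_mul_left, tsum_mul_left]
  have eV : V = -(Real.sqrt 3 / 4) * U - (1 / 2) * V := by
    calc V = ∑' ij : ℤ × ℤ, w (ρ ij) * (X (ρ ij) * Y (ρ ij)) :=
          (Equiv.tsum_eq ρ (fun ij => w ij * (X ij * Y ij))).symm
      _ = ∑' ij : ℤ × ℤ, (-(Real.sqrt 3 / 4) * (w ij * (X ij ^ 2 - Y ij ^ 2)) - (1 / 2) * (w ij * (X ij * Y ij))) :=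
          tsum_congr fun ij => by
            rw [hρ, hw, rX, rY]; linear_combination (-(1 / 4) * w ij * (X ij * Y ij)) * h3
      _ = -(Real.sqrt 3 / 4) * U - (1 / 2) * V := by
          rw [(hU.mul_left _).tsum_sub (hV.mul_left _), tsum_mul_left, tsum_mul_left]
  have hS0 : S = 0 := by linear_combination (1 / 2 : ℝ) * eS - (Real.sqrt 3 / 6) * eT - (S / 12) * h3
  have hT0 : T = 0 := by linear_combination (2 / 3 : ℝ) * eT + (Real.sqrt 3 / 3) * hS0
  have hU0 : U = 0 := by linear_combination (1 / 2 : ℝ) * eU + (Real.sqrt 3 / 3) * eV - (U / 12) * h3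
  have hV0 : V = 0 := by linear_combination (2 / 3 : ℝ) * eV - (Real.sqrt 3 / 6) * hU0
  have e : ∑' ij : ℤ × ℤ, w ij * (c₁ * X ij + c₂ * Y ij + c₃ * (X ij ^ 2 - Y ij ^ 2) + c₄ * (X ij * Y ij)) =
      c₁ * S + c₂ * T + c₃ * U + c₄ * V := by
    have h1 := ((hX.mul_left c₁).add (hY.mul_left c₂)).add (hU.mul_left c₃)
    rw [hS, hT, hUd, hVd, ← tsum_mul_left, ← tsum_mul_left, ← tsum_mul_left, ← tsum_mul_left,
      ← (hX.mul_left c₁).tsum_add (hY.mul_left c₂), ← Summable.tsum_add ((hX.mul_left c₁).add (hY.mul_left c₂)) (hU.mul_left c₃),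
      ← h1.tsum_add (hV.mul_left c₄)]
    exact tsum_congr fun ij => by ring
  show ∑' ij : ℤ × ℤ, w ij * (c₁ * X ij + c₂ * Y ij + c₃ * (X ij ^ 2 - Y ij ^ 2) + c₄ * (X ij * Y ij)) = 0
  rw [e, hS0, hT0, hU0, hV0]; ring

end Summit.AtomisticToContinuum.Crystallization.Theorems.NashClassCertificatesNashNearField

end
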